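import Literature.NumberTheory.EllipticCurves.SigmaNormFormalLogProofs
import Literature.NumberTheory.EllipticCurves.PadicSigmaSqTwistTransportProofs
import Literature.NumberTheory.EllipticCurves.CanonicalPAdicHeightCyc
import Mathlib.Topology.Algebra.InfiniteSum.Nonarchimedean
import HarnessLib

/-!
# The norm of the sigma-squared function through a rational `x`-coordinate:
# `2·log_p N(z) + Σ_n ℒ_n·Tr(zⁿ) = 2·log_p 𝔖_p(1/x)` (proofs only)

Topic `Literature/NumberTheory/EllipticCurves` (trunk T-NT-EC); PROOFS file (theorems only: no
definition, no named fact, no instance). Sequel of `SigmaNormFormalLogProofs.lean` (the formal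
identity `(2 log 𝔖₁ + 2 log D)(1/x) = ℒ(z) + ℒ(i(z))` and its coefficients as power sums),
`PadicLogOfEvalProofs.lean` (`log_p F(u) = (log F)(u)`) and `CanonicalPAdicHeightCyc.lean` (the series
`ℒ_p = padicLogSigmaSqShift = log(Σ_p/t²)` of the cyclotomic height receptacle). Width seat
`bsd-line-cf2-p1-w8` (g26), BSD cell `bsd-print-cf2`, towards the route-A aside
stmt-BirchSwinnertonDyer-27316 (`isCanonicalCyc_pairing_eq_minusTwist`).

## Result (`two_mul_padicLog_add_tsum_eq`)

Let `W/ℚ_p` be `ℤ_p`-integral with a sigma-squared pair (`IsMazurTateSigmaSqPair`, so `Σ_p =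
padicSigmaSq W` is even, integral, `= t² + ⋯`), `𝔖` an `x⁻¹`-expansion of `Σ_p`
(`IsInvXExpansion`), `w ∈ ℚ_p` with `0 < ‖w‖ < 1`, and put `D = 1 + a₂w + a₄w² + a₆w³`,
`e = −w/D`, `s = −(a₁w + a₃w²)/D` — the VALUES at `w = 1/x` of the product and the sum of the two
formal parameters `z, z̄ = i(z)` above `x` (`FormalGroupInvXVietaProofs`). Then for every sequence
`t : ℕ → ℚ_p` with `t₀ = 2`, `t₁ = s`, `t_{n+2} = s·t_{n+1} − e·t_n` (the power sums of `z, z̄`):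

  `2·log_p e + Σ'_n [tⁿ]ℒ_p · t_n = 2·log_p 𝔖(w)`,

and the series converges (`hasSum_coeff_padicLogSigmaSqShift_mul_powerSum`). For a point `P` of
`E(F′)`, `F′ = ℚ(z(P))` quadratic, with RATIONAL `x(P) = 1/w`, `e = N_{F′/ℚ} z(P)` and
`t_n = Tr_{F′/ℚ}(z(P)ⁿ)`, so the left side is `ℚ`-rationally the `F′`-part of `sigmaSqNormLog`, and
the identity says `Σ_{𝔓∣p} log_p N_{F′_𝔓/ℚ_p} Σ_p(z_𝔓(P)) = 2·log_p 𝔖_p(1/x(P))` WITHOUT completing `F′`.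

## Method (pure `ℚ_p`: no extension of `log_p` beyond `ℚ_p`)

`t_n = Π_n(w)` for the Newton power-sum SERIES `Π_n ∈ ℤ_p⟦w⟧` (evaluation is a ring map on integral
series); the double family `(n,k) ↦ ℒ_n·[w^k]Π_n·w^k` is summable (`‖ℒ_n‖ ≤ n`, `Π_n = O(w^{⌈n/2⌉})`,
nonarchimedean summability), so `Σ_n ℒ_n t_n = Σ_k (Σ_{n≤2k} ℒ_n[w^k]Π_n) w^k = Σ_k [w^k]M w^k` with
`M = 2 log 𝔖₁ + 2 log D` (`coeff_eq_sum_coeff_mul_coeff_powerSum`, `two_mul_add_subst_formalInvX_eq`),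
`= 2 log_p 𝔖₁(w) + 2 log_p D(w)` (`padicLog_padicEval`); finally `log_p e = log_p w − log_p D(w)` and
`log_p 𝔖(w) = log_p w + log_p 𝔖₁(w)` (`𝔖 = w𝔖₁`, multiplicativity of `log_p`, `log_p(−1) = 0`).

## References

* B. Mazur, W. Stein, J. Tate, Doc. Math. Extra Vol. Coates (2006), §2.7–2.8 (`h_p` via `σ_v`,
  `ρ^K_cycl = ρ^ℚ_cycl ∘ N_{K/ℚ}`, `Σ_{v∣p} log_p N_{K_v/ℚ_p} σ_v`). [MazurSteinTate2006]
* J. H. Silverman, Math. Ann. 332 (2005), §5 Rem. 2 (`σ²` even, defined over `ℤ_p`). [Silverman2005DivPoly]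
* J. H. Silverman, *AEC* (2009), IV.1, IV.6.3–6.4. [SilvermanAEC2009]
* K. Iwasawa, *Lectures on p-adic L-functions* (1972), §4.4. [Iwasawa1972PadicL]
-/

noncomputable section

open scoped Classical
open PowerSeries Filter Literature.NumberTheory.EllipticCurves
open scoped Topology

namespace WeierstrassCurve

variable {p : ℕ} [Fact p.Prime]

/-! ### §1 Integrality and formal-logarithm plumbing over `ℚ_p` -/

section Plumbing

/-- Shifting preserves integrality. [folklore] -/
private theorem isPadicInt_sigmaShift' {T : ℚ_[p]⟦X⟧} (hT : IsPadicInt T) :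
    IsPadicInt (sigmaShift T) := by
  rw [isPadicInt_iff_coeff] at hT ⊢
  intro n; rw [coeff_sigmaShift]; exact hT _

/-- The derivative of an integral series is integral (`‖n+1‖_p ≤ 1`). [folklore] -/
private theorem isPadicInt_derivative' {F : ℚ_[p]⟦X⟧} (hF : IsPadicInt F) :
    IsPadicInt (d⁄dX ℚ_[p] F) := by
  rw [isPadicInt_iff_coeff] at hF ⊢
  intro n
  rw [coeff_derivative, norm_mul]
  have h1 : ‖((n : ℚ_[p]) + 1)‖ ≤ 1 := by exact_mod_cast norm_natCast_le_one (p := p) (n + 1)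
  exact mul_le_one₀ (hF _) (norm_nonneg _) h1

/-- `invOfUnit 1` commutes with the coefficient map `ℤ_p → ℚ_p` (series with constant term `1`).
[folklore] -/
private theorem map_invOfUnit_one' {G : ℤ_[p]⟦X⟧} (hG : constantCoeff G = 1) :
    PowerSeries.map PadicInt.Coe.ringHom (G.invOfUnit 1) =
      (PowerSeries.map PadicInt.Coe.ringHom G).invOfUnit 1 := by
  set φ := PadicInt.Coe.ringHom (p := p)
  have hG' : constantCoeff (PowerSeries.map φ G) = 1 := by
    rw [← coeff_zero_eq_constantCoeff_apply, coeff_map, coeff_zero_eq_constantCoeff_apply, hG, map_one]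
  have h1 : PowerSeries.map φ G * PowerSeries.map φ (G.invOfUnit 1) = 1 := by
    rw [← map_mul, mul_invOfUnit G 1 (by rw [hG, Units.val_one]), map_one]
  have h2 : PowerSeries.map φ G * (PowerSeries.map φ G).invOfUnit 1 = 1 :=
    mul_invOfUnit _ 1 (by rw [hG', Units.val_one])
  exact (IsUnit.of_mul_eq_one _ h2).mul_left_cancel (h1.trans h2.symm)

/-- The inverse of an integral series with constant term `1` is integral. [folklore] -/
private theorem isPadicInt_invOfUnit_one' {F : ℚ_[p]⟦X⟧} (hF : IsPadicInt F)
    (hF0 : constantCoeff F = 1) : IsPadicInt (F.invOfUnit 1) := by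
  obtain ⟨G, rfl⟩ := isPadicInt_iff_exists_powerSeries_map.mp hF
  have hG : constantCoeff G = 1 := by
    apply Subtype.ext
    have h := hF0
    rw [← coeff_zero_eq_constantCoeff_apply, coeff_map, coeff_zero_eq_constantCoeff_apply] at h
    exact h
  rw [← map_invOfUnit_one' hG]
  exact isPadicInt_map _

/-- **Every `F ∈ ℚ_p⟦X⟧` with `F(0) = 1` has a formal logarithm** `L` (`L(0) = 0`, `dL·F = dF`): the
Mercator series composed with `F − 1`. [cite: BourbakiAlgebraII2003, IV.§4 no. 3] -/
theorem exists_formalLog {F : ℚ_[p]⟦X⟧} (hF0 : constantCoeff F = 1) :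
    ∃ L : ℚ_[p]⟦X⟧, constantCoeff L = 0 ∧ d⁄dX ℚ_[p] L * F = d⁄dX ℚ_[p] F := by
  set Λ : ℚ_[p]⟦X⟧ := PowerSeries.mk fun k => if k = 0 then 0 else (-1) ^ (k + 1) / (k : ℚ_[p])
    with hΛdef
  have hΛ : ∀ k, coeff k Λ = if k = 0 then 0 else (-1) ^ (k + 1) / (k : ℚ_[p]) := fun k => by
    rw [hΛdef, coeff_mk]
  set A : ℚ_[p]⟦X⟧ := F - 1 with hAdef
  have hA0 : constantCoeff A = 0 := by rw [hAdef, map_sub, hF0, map_one, sub_self]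
  have hs : HasSubst A := HasSubst.of_constantCoeff_zero' hA0
  have hFA : F = 1 + A := by rw [hAdef, add_sub_cancel]
  refine ⟨Λ.subst A, ?_, ?_⟩
  · rw [constantCoeff_subst_of_constantCoeff Λ hA0, constantCoeff_mercator hΛ]
  · have h1 : (d⁄dX ℚ_[p] Λ).subst A * F = 1 := by
      have h := congrArg (PowerSeries.subst A) (derivative_mercator_mul_one_add_X hΛ)
      rwa [subst_mul hs, subst_add hs, subst_X hs, one_subst_of_constantCoeff hA0, ← hFA] at h
    have hdA : d⁄dX ℚ_[p] A = d⁄dX ℚ_[p] F := by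
      rw [hAdef, map_sub, show d⁄dX ℚ_[p] (1 : ℚ_[p]⟦X⟧) = 0 from (d⁄dX ℚ_[p]).map_one_eq_zero,
        sub_zero]
    rw [derivative_subst ℚ_[p] hs, mul_assoc, mul_comm (d⁄dX ℚ_[p] A) F, ← mul_assoc, h1, one_mul, hdA]

/-- An integral series with constant term `1` takes nonzero (indeed principal-unit) values on the
open unit disc. [folklore] -/
private theorem padicEval_ne_zero_of_constantCoeff_one {F : ℚ_[p]⟦X⟧} (hF : IsPadicInt F)
    (hF0 : constantCoeff F = 1) {w : ℚ_[p]} (hw : ‖w‖ < 1) : padicEval F w ≠ 0 := by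
  have hA : IsPadicInt (F - 1) := hF.sub IsPadicInt.one
  have hA0 : constantCoeff (F - 1) = 0 := by rw [map_sub, hF0, map_one, sub_self]
  have hv : ‖padicEval (F - 1) w‖ < 1 := norm_padicEval_lt_one hA hA0 hw
  have hFw : padicEval F w = 1 + padicEval (F - 1) w := by
    rw [← padicEval_one w, ← padicEval_add IsPadicInt.one hA hw, add_sub_cancel]
  intro h0
  rw [hFw] at h0
  have : ‖padicEval (F - 1) w‖ = 1 := by
    rw [show padicEval (F - 1) w = -1 by linear_combination h0, norm_neg, norm_one]
  exact absurd this hv.ne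

end Plumbing

/-! ### §2 The series `ℒ_p = log(Σ_p/t²)`: bounds and the log-derivative relation -/

section LSeries

variable (W : WeierstrassCurve ℚ_[p])

/-- With `S = Σ_p/t²` (`sigmaShift` twice): **`dℒ_p · S = dS`** whenever `S(0) = 1` — the defining
relation `[tⁿ]ℒ = n⁻¹[tⁿ⁻¹](S′S⁻¹)` says `dℒ = S′·S⁻¹`. [cite: MazurSteinTate2006, §2.7] -/
theorem derivative_padicLogSigmaSqShift_mul
    (hS0 : constantCoeff (sigmaShift (sigmaShift W.padicSigmaSq)) = 1) :
    d⁄dX ℚ_[p] W.padicLogSigmaSqShift * sigmaShift (sigmaShift W.padicSigmaSq) =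
      d⁄dX ℚ_[p] (sigmaShift (sigmaShift W.padicSigmaSq)) := by
  set S := sigmaShift (sigmaShift W.padicSigmaSq) with hS
  have hSi : S * S.invOfUnit 1 = 1 := mul_invOfUnit S 1 (by rw [hS0, Units.val_one])
  have hd : d⁄dX ℚ_[p] W.padicLogSigmaSqShift = d⁄dX ℚ_[p] S * S.invOfUnit 1 := by
    ext n
    have hn : ((n : ℚ_[p]) + 1) ≠ 0 := by exact_mod_cast Nat.succ_ne_zero n
    rw [coeff_derivative, W.coeff_padicLogSigmaSqShift_of_ne_zero (Nat.succ_ne_zero n),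
      Nat.succ_sub_one]
    push_cast
    rw [div_mul_cancel₀ _ hn]
  rw [hd, mul_assoc, mul_comm (S.invOfUnit 1) S, hSi, mul_one]

/-- **`‖[tⁿ]ℒ_p‖ ≤ n`** when `Σ_p ∈ t² + t³ℤ_p⟦t⟧` (`S′S⁻¹` is integral, `‖n⁻¹‖_p ≤ n`).
[cite: MazurSteinTate2006, §2.7] [cite: SilvermanAEC2009, IV.6.3] -/
theorem norm_coeff_padicLogSigmaSqShift_le (hint : IsPadicInt W.padicSigmaSq)
    (hS0 : constantCoeff (sigmaShift (sigmaShift W.padicSigmaSq)) = 1) (n : ℕ) :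
    ‖coeff n W.padicLogSigmaSqShift‖ ≤ n := by
  rcases Nat.eq_zero_or_pos n with rfl | hn
  · rw [coeff_zero_eq_constantCoeff, W.constantCoeff_padicLogSigmaSqShift, norm_zero, Nat.cast_zero]
  · have hS : IsPadicInt (sigmaShift (sigmaShift W.padicSigmaSq)) :=
      isPadicInt_sigmaShift' (isPadicInt_sigmaShift' hint)
    have hQ : IsPadicInt (d⁄dX ℚ_[p] (sigmaShift (sigmaShift W.padicSigmaSq)) *
        (sigmaShift (sigmaShift W.padicSigmaSq)).invOfUnit 1) :=
      (isPadicInt_derivative' hS).mul (isPadicInt_invOfUnit_one' hS hS0)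
    rw [W.coeff_padicLogSigmaSqShift_of_ne_zero hn.ne', norm_div, div_eq_mul_inv, ← norm_inv]
    calc ‖coeff (n - 1) (d⁄dX ℚ_[p] (sigmaShift (sigmaShift W.padicSigmaSq)) *
          (sigmaShift (sigmaShift W.padicSigmaSq)).invOfUnit 1)‖ * ‖((n : ℚ_[p]))⁻¹‖
        ≤ 1 * n := by
          gcongr
          · exact isPadicInt_iff_coeff.mp hQ _
          · exact norm_inv_natCast_le hn.ne'
      _ = n := one_mul _

end LSeries

/-! ### §3 The norm identity -/

section NormIdentity

variable (W : WeierstrassCurve ℚ_[p]) [W.IsIntegral ℤ_[p]]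

/-- **`2·log_p e + Σ'_n [tⁿ]ℒ_p·t_n = 2·log_p 𝔖(w)`, convergent** — for `W/ℚ_p` `ℤ_p`-integral with a
sigma-squared pair, `𝔖` an `x⁻¹`-expansion of `Σ_p`, `0 < ‖w‖ < 1`, `D = 1 + a₂w + a₄w² + a₆w³`,
`e = −w/D`, `s = −(a₁w + a₃w²)/D`, and any `t` with `t₀ = 2`, `t₁ = s`, `t_{n+2} = s t_{n+1} − e t_n`
(the power sums of the two formal parameters above `x = 1/w`): the series `Σ_n [tⁿ]ℒ_p · t_n` converges
to `2·log_p 𝔖(w) − 2·log_p e`. [cite: MazurSteinTate2006, §2.8] [cite: Silverman2005DivPoly, §5 Rem. 2] -/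
theorem hasSum_coeff_padicLogSigmaSqShift_mul_powerSum
    (hpair : ∃ Sq : ℚ_[p]⟦X⟧, ∃ c : ℚ_[p], W.IsMazurTateSigmaSqPair Sq c) {Sx : ℚ_[p]⟦X⟧}
    (hinv : W.IsInvXExpansion W.padicSigmaSq Sx) {w : ℚ_[p]} (hw : ‖w‖ < 1) (hw0 : w ≠ 0)
    (t : ℕ → ℚ_[p]) (ht0 : t 0 = 2)
    (ht1 : t 1 = -(W.a₁ * w + W.a₃ * w ^ 2) / (1 + W.a₂ * w + W.a₄ * w ^ 2 + W.a₆ * w ^ 3))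
    (ht : ∀ n, t (n + 2) =
      -(W.a₁ * w + W.a₃ * w ^ 2) / (1 + W.a₂ * w + W.a₄ * w ^ 2 + W.a₆ * w ^ 3) * t (n + 1) -
        -w / (1 + W.a₂ * w + W.a₄ * w ^ 2 + W.a₆ * w ^ 3) * t n) :
    HasSum (fun n : ℕ => coeff n W.padicLogSigmaSqShift * t n)
      (2 * padicLog p (padicEval Sx w) -
        2 * padicLog p (-w / (1 + W.a₂ * w + W.a₄ * w ^ 2 + W.a₆ * w ^ 3))) := by
  -- the sigma data
  have hSig := W.isMazurTateSigmaSqPair_padicSigmaSq (Or.inr hpair)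
  have hintSig : IsPadicInt W.padicSigmaSq := isPadicInt_iff_coeff.mpr hSig.norm_coeff_le
  have h0 := hSig.constantCoeff_eq
  have h1 := hSig.coeff_one_eq
  have h2 := hSig.coeff_two_eq
  have heven := hSig.even
  set S := sigmaShift (sigmaShift W.padicSigmaSq) with hSdef
  set S₁ := sigmaShift Sx with hS₁def
  have hS0 : constantCoeff S = 1 := constantCoeff_sigmaShift_sigmaShift h2
  have hS₁0 : constantCoeff S₁ = 1 := by
    rw [hS₁def, constantCoeff_sigmaShift, coeff_one_invX_eq_one hinv h0 h2]
  have hintS : IsPadicInt S := isPadicInt_sigmaShift' (isPadicInt_sigmaShift' hintSig)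
  have hintSx : IsPadicInt Sx := hinv.isPadicInt hintSig
  have hintS₁ : IsPadicInt S₁ := isPadicInt_sigmaShift' hintSx
  have hSx0 : constantCoeff Sx = 0 := constantCoeff_invX_eq_zero hinv h0
  obtain ⟨ha₁, ha₂, ha₃, ha₄, ha₆⟩ := W.norm_coeffs_le_one
  -- the cubic `D(w)` and its inverse
  set Dw : ℚ_[p]⟦X⟧ := 1 + C W.a₂ * X + C W.a₄ * X ^ 2 + C W.a₆ * X ^ 3 with hDwdef
  have hDw0 : constantCoeff Dw = 1 := by simp [hDwdef]
  have hintD : IsPadicInt Dw :=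
    ((IsPadicInt.one.add ((IsPadicInt.powerSeries_C ha₂).mul IsPadicInt.powerSeries_X)).add
      ((IsPadicInt.powerSeries_C ha₄).mul (IsPadicInt.powerSeries_X.pow 2))).add
      ((IsPadicInt.powerSeries_C ha₆).mul (IsPadicInt.powerSeries_X.pow 3))
  have hintDi : IsPadicInt (Dw.invOfUnit 1) := isPadicInt_invOfUnit_one' hintD hDw0
  have hDDi : Dw * Dw.invOfUnit 1 = 1 := mul_invOfUnit Dw 1 (by rw [hDw0, Units.val_one])
  -- numeric values
  set Dv : ℚ_[p] := 1 + W.a₂ * w + W.a₄ * w ^ 2 + W.a₆ * w ^ 3 with hDvdef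
  have hDv : padicEval Dw w = Dv := by
    rw [hDwdef, padicEval_add ((IsPadicInt.one.add ((IsPadicInt.powerSeries_C ha₂).mul
        IsPadicInt.powerSeries_X)).add ((IsPadicInt.powerSeries_C ha₄).mul
        (IsPadicInt.powerSeries_X.pow 2))) ((IsPadicInt.powerSeries_C ha₆).mul
        (IsPadicInt.powerSeries_X.pow 3)) hw,
      padicEval_add (IsPadicInt.one.add ((IsPadicInt.powerSeries_C ha₂).mul IsPadicInt.powerSeries_X))
        ((IsPadicInt.powerSeries_C ha₄).mul (IsPadicInt.powerSeries_X.pow 2)) hw,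
      padicEval_add IsPadicInt.one ((IsPadicInt.powerSeries_C ha₂).mul IsPadicInt.powerSeries_X) hw,
      padicEval_mul (IsPadicInt.powerSeries_C ha₂) IsPadicInt.powerSeries_X hw,
      padicEval_mul (IsPadicInt.powerSeries_C ha₄) (IsPadicInt.powerSeries_X.pow 2) hw,
      padicEval_mul (IsPadicInt.powerSeries_C ha₆) (IsPadicInt.powerSeries_X.pow 3) hw,
      padicEval_pow IsPadicInt.powerSeries_X hw, padicEval_pow IsPadicInt.powerSeries_X hw,
      padicEval_one, padicEval_C, padicEval_C, padicEval_C, padicEval_X]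
  have hDv0 : Dv ≠ 0 := by
    rw [← hDv]; exact padicEval_ne_zero_of_constantCoeff_one hintD hDw0 hw
  have hDiv : padicEval (Dw.invOfUnit 1) w = Dv⁻¹ := by
    rw [← hDv]; exact padicEval_eq_inv_of_mul_eq_one hintD hintDi hDDi hw
  -- the Vieta series and their values
  set Ew : ℚ_[p]⟦X⟧ := -(X * Dw.invOfUnit 1) with hEwdef
  set Sw : ℚ_[p]⟦X⟧ := -((C W.a₁ * X + C W.a₃ * X ^ 2) * Dw.invOfUnit 1) with hSwdef
  have hintE : IsPadicInt Ew := (IsPadicInt.powerSeries_X.mul hintDi).neg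
  have hintSlin : IsPadicInt (C W.a₁ * X + C W.a₃ * X ^ 2 : ℚ_[p]⟦X⟧) :=
    ((IsPadicInt.powerSeries_C ha₁).mul IsPadicInt.powerSeries_X).add
      ((IsPadicInt.powerSeries_C ha₃).mul (IsPadicInt.powerSeries_X.pow 2))
  have hintSw : IsPadicInt Sw := (hintSlin.mul hintDi).neg
  have hEw0 : constantCoeff Ew = 0 := by simp [hEwdef]
  have hSw0 : constantCoeff Sw = 0 := by simp [hSwdef]
  have hEv : padicEval Ew w = -w / Dv := by
    rw [hEwdef, padicEval_neg (IsPadicInt.powerSeries_X.mul hintDi) hw,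
      padicEval_mul IsPadicInt.powerSeries_X hintDi hw, padicEval_X, hDiv, div_eq_mul_inv, neg_mul]
  have hSv : padicEval Sw w = -(W.a₁ * w + W.a₃ * w ^ 2) / Dv := by
    rw [hSwdef, padicEval_neg (hintSlin.mul hintDi) hw, padicEval_mul hintSlin hintDi hw,
      padicEval_add ((IsPadicInt.powerSeries_C ha₁).mul IsPadicInt.powerSeries_X)
        ((IsPadicInt.powerSeries_C ha₃).mul (IsPadicInt.powerSeries_X.pow 2)) hw,
      padicEval_mul (IsPadicInt.powerSeries_C ha₁) IsPadicInt.powerSeries_X hw,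
      padicEval_mul (IsPadicInt.powerSeries_C ha₃) (IsPadicInt.powerSeries_X.pow 2) hw,
      padicEval_pow IsPadicInt.powerSeries_X hw, padicEval_C, padicEval_C, padicEval_X, hDiv,
      div_eq_mul_inv, neg_mul]
  have hSwι : Sw.subst W.formalInvX = X + W.formalNeg := W.sumSeries_subst_formalInvX
  have hEwι : Ew.subst W.formalInvX = X * W.formalNeg := W.prodSeries_subst_formalInvX
  -- the Newton power-sum series
  let q : ℕ → ℚ_[p]⟦X⟧ × ℚ_[p]⟦X⟧ := fun n =>
    Nat.rec (motive := fun _ => ℚ_[p]⟦X⟧ × ℚ_[p]⟦X⟧) (2, Sw) (fun _ r => (r.2, Sw * r.2 - Ew * r.1)) n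
  let Pw : ℕ → ℚ_[p]⟦X⟧ := fun n => (q n).1
  have hPw0 : Pw 0 = 2 := rfl
  have hPw1 : Pw 1 = Sw := rfl
  have hPw : ∀ n, Pw (n + 2) = Sw * Pw (n + 1) - Ew * Pw n := fun n => rfl
  -- integrality and values of the power sums
  have hPint : ∀ n, (IsPadicInt (Pw n) ∧ IsPadicInt (Pw (n + 1))) ∧
      (padicEval (Pw n) w = t n ∧ padicEval (Pw (n + 1)) w = t (n + 1)) := by
    intro n
    induction n with
    | zero =>
      refine ⟨⟨?_, by rw [zero_add, hPw1]; exact hintSw⟩, ?_, ?_⟩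
      · rw [hPw0, show (2 : ℚ_[p]⟦X⟧) = C (2 : ℚ_[p]) from (map_ofNat C 2).symm]
        exact IsPadicInt.powerSeries_C (by simpa using norm_natCast_le_one (p := p) 2)
      · rw [hPw0, ht0, show (2 : ℚ_[p]⟦X⟧) = C (2 : ℚ_[p]) from (map_ofNat C 2).symm, padicEval_C]
      · rw [zero_add, hPw1, ht1, hSv]
    | succ n ih =>
      obtain ⟨⟨hi0, hi1⟩, hv0, hv1⟩ := ih
      refine ⟨⟨hi1, ?_⟩, hv1, ?_⟩
      · rw [show n + 1 + 1 = n + 2 from rfl, hPw n]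
        exact (hintSw.mul hi1).sub (hintE.mul hi0)
      · rw [show n + 1 + 1 = n + 2 from rfl, hPw n, padicEval_sub (hintSw.mul hi1) (hintE.mul hi0) hw,
          padicEval_mul hintSw hi1 hw, padicEval_mul hintE hi0 hw, hSv, hEv, hv0, hv1, ht n]
  -- formal logarithms of `S₁` and `Dw`, and the log identity
  obtain ⟨L₁, hL₁0, hL₁⟩ := exists_formalLog hS₁0
  obtain ⟨L_D, hLD0, hLD⟩ := exists_formalLog hDw0
  have hℒ0 := W.constantCoeff_padicLogSigmaSqShift
  have hℒ := W.derivative_padicLogSigmaSqShift_mul hS0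
  have hM : (2 * L₁ + 2 * L_D).subst W.formalInvX =
      W.padicLogSigmaSqShift + W.padicLogSigmaSqShift.subst W.formalNeg :=
    two_mul_add_subst_formalInvX_eq hinv h0 h1 h2 heven hℒ0 hℒ hL₁0 hL₁ hLD0 hLD
  have hcoef : ∀ k, coeff k (2 * L₁ + 2 * L_D) =
      ∑ n ∈ Finset.range (2 * k + 1), coeff n W.padicLogSigmaSqShift * coeff k (Pw n) :=
    coeff_eq_sum_coeff_mul_coeff_powerSum hSwι hEwι hSw0 hEw0 Pw hPw0 hPw1 hPw hM
  have hπ0 : ∀ {n k : ℕ}, 2 * k < n → coeff k (Pw n) = 0 := fun h =>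
    coeff_powerSum_eq_zero Pw hPw1 hPw hSw0 hEw0 h
  -- `Σ_k [w^k]M w^k = 2 log S₁(w) + 2 log D(w)`
  have hM1 : HasSum (fun k : ℕ => coeff k L₁ * w ^ k) (padicLog p (padicEval S₁ w)) :=
    hasSum_coeff_formalLog_mul_pow hintS₁ hS₁0 hL₁0 hL₁ hw
  have hM2 : HasSum (fun k : ℕ => coeff k L_D * w ^ k) (padicLog p Dv) := by
    rw [← hDv]; exact hasSum_coeff_formalLog_mul_pow hintD hDw0 hLD0 hLD hw
  have hMsum : HasSum (fun k : ℕ => coeff k (2 * L₁ + 2 * L_D) * w ^ k)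
      (2 * padicLog p (padicEval S₁ w) + 2 * padicLog p Dv) := by
    have h := (hM1.mul_left 2).add (hM2.mul_left 2)
    have hfun : (fun k : ℕ => coeff k (2 * L₁ + 2 * L_D) * w ^ k) =
        fun k : ℕ => 2 * (coeff k L₁ * w ^ k) + 2 * (coeff k L_D * w ^ k) := by
      funext k
      rw [map_add, show (2 : ℚ_[p]⟦X⟧) = C (2 : ℚ_[p]) from (map_ofNat C 2).symm, coeff_C_mul,
        coeff_C_mul]
      ring
    rw [hfun]
    exact h
  -- the double family `(n, k) ↦ ℒ_n [w^k]Π_n w^k` is summable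
  set F : ℕ × ℕ → ℚ_[p] := fun x => coeff x.1 W.padicLogSigmaSqShift * (coeff x.2 (Pw x.1) * w ^ x.2)
    with hFdef
  have hℒn : ∀ n, ‖coeff n W.padicLogSigmaSqShift‖ ≤ n := W.norm_coeff_padicLogSigmaSqShift_le hintSig hS0
  have hπint : ∀ n k, ‖coeff k (Pw n)‖ ≤ 1 := fun n k => isPadicInt_iff_coeff.mp (hPint n).1.1 k
  have hsum : Summable F := by
    refine NonarchimedeanAddGroup.summable_of_tendsto_cofinite_zero ?_
    set r := ‖w‖ with hr
    have hr0 : 0 ≤ r := norm_nonneg w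
    have hbound : ∀ x : ℕ × ℕ, ‖F x‖ ≤ 2 * x.2 * r ^ x.2 := by
      rintro ⟨n, k⟩
      simp only [hFdef]
      by_cases hnk : 2 * k < n
      · rw [hπ0 hnk, zero_mul, mul_zero, norm_zero]
        exact mul_nonneg (mul_nonneg zero_le_two (Nat.cast_nonneg _)) (pow_nonneg hr0 _)
      · push Not at hnk
        have b5 : (n : ℝ) ≤ 2 * k := by exact_mod_cast hnk
        rw [norm_mul, norm_mul, norm_pow]
        calc ‖coeff n W.padicLogSigmaSqShift‖ * (‖coeff k (Pw n)‖ * ‖w‖ ^ k) ≤ n * (1 * r ^ k) := by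
              gcongr
              · exact hℒn n
              · exact hπint n k
          _ ≤ 2 * k * r ^ k := by rw [one_mul]; gcongr
    rw [NormedAddGroup.tendsto_nhds_zero]
    intro ε hε
    obtain ⟨N, hN⟩ : ∃ N : ℕ, ∀ m, N ≤ m → 2 * (m : ℝ) * r ^ m < ε := by
      have h := (tendsto_self_mul_const_pow_of_lt_one hr0 hw).const_mul 2
      rw [mul_zero, Metric.tendsto_atTop] at h
      obtain ⟨N, hN⟩ := h ε hε
      refine ⟨N, fun m hm => ?_⟩
      have := hN m hm
      rw [Real.dist_eq, sub_zero, ← mul_assoc,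
        abs_of_nonneg (mul_nonneg (mul_nonneg zero_le_two (Nat.cast_nonneg _)) (pow_nonneg hr0 _))]
        at this
      exact this
    have hfin : {x : ℕ × ℕ | x.1 ≤ 2 * x.2 ∧ x.2 < N}.Finite := by
      refine ((Set.finite_Iio (2 * N + 1)).prod (Set.finite_Iio N)).subset ?_
      intro x hx
      obtain ⟨hx1, hx2⟩ := hx
      simp only [Set.mem_prod, Set.mem_Iio]
      exact ⟨by omega, hx2⟩
    rw [Filter.eventually_cofinite]
    refine hfin.subset fun x hx => ?_
    simp only [Set.mem_setOf_eq] at hx ⊢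
    have hx' := not_lt.mp hx
    by_contra hcon
    push Not at hcon
    by_cases hnk : 2 * x.2 < x.1
    · have : F x = 0 := by simp only [hFdef]; rw [hπ0 hnk, zero_mul, mul_zero]
      rw [this, norm_zero] at hx'
      exact absurd hε (not_lt.mpr hx')
    · push Not at hnk
      exact absurd ((hbound x).trans_lt (hN _ (hcon hnk))) (not_lt.mpr hx')
  -- rows: `Σ_k F(n,k) = ℒ_n t_n`
  have hrows : HasSum (fun n : ℕ => coeff n W.padicLogSigmaSqShift * t n) (∑' x, F x) := by
    refine hsum.hasSum.prod_fiberwise fun n => ?_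
    simp only [hFdef]
    rw [← (hPint n).2.1]
    exact (hasSum_padicEval (hPint n).1.1 hw).mul_left _
  -- columns: `Σ_n F(n,k) = [w^k]M w^k`
  have hsum' := (Equiv.prodComm ℕ ℕ).summable_iff.mpr hsum
  have hcols : HasSum (fun k : ℕ => coeff k (2 * L₁ + 2 * L_D) * w ^ k) (∑' y : ℕ × ℕ, F (y.2, y.1)) := by
    refine hsum'.hasSum.prod_fiberwise fun k => ?_
    have hfinsum : HasSum (fun n : ℕ => F (n, k))
        (∑ n ∈ Finset.range (2 * k + 1), F (n, k)) :=
      hasSum_sum_of_ne_finset_zero fun n hn => by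
        rw [Finset.mem_range, not_lt] at hn
        simp only [hFdef]
        rw [hπ0 (by omega), zero_mul, mul_zero]
    have hv : (∑ n ∈ Finset.range (2 * k + 1), F (n, k)) = coeff k (2 * L₁ + 2 * L_D) * w ^ k := by
      rw [hcoef k, Finset.sum_mul]
      exact Finset.sum_congr rfl fun n _ => by simp only [hFdef]; ring
    rw [← hv]
    exact hfinsum
  have hcolval : (∑' y : ℕ × ℕ, F (y.2, y.1)) = ∑' x, F x := (Equiv.prodComm ℕ ℕ).tsum_eq F
  rw [hcolval] at hcols
  have htot : (∑' x, F x) = 2 * padicLog p (padicEval S₁ w) + 2 * padicLog p Dv :=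
    hcols.unique hMsum
  -- bookkeeping of logarithms
  have hmul : padicLog_mul p := padicLog_mul_holds p
  have hS₁v0 : padicEval S₁ w ≠ 0 := padicEval_ne_zero_of_constantCoeff_one hintS₁ hS₁0 hw
  have hSxv : padicEval Sx w = w * padicEval S₁ w := by
    rw [← X_mul_sigmaShift_invX hinv h0, padicEval_mul IsPadicInt.powerSeries_X hintS₁ hw, padicEval_X]
  have hlogSx : padicLog p (padicEval Sx w) = padicLog p w + padicLog p (padicEval S₁ w) := by
    rw [hSxv, hmul hw0 hS₁v0]
  have hloge : padicLog p (-w / Dv) = padicLog p w - padicLog p Dv := by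
    have hinv' : padicLog p Dv⁻¹ = -padicLog p Dv := by
      have h := hmul hDv0 (inv_ne_zero hDv0)
      rw [mul_inv_cancel₀ hDv0, padicLog_one] at h
      linear_combination -h
    rw [div_eq_mul_inv, show -w * Dv⁻¹ = -1 * (w * Dv⁻¹) by ring,
      hmul (by norm_num) (mul_ne_zero hw0 (inv_ne_zero hDv0)), padicLog_neg_one, zero_add,
      hmul hw0 (inv_ne_zero hDv0), hinv', ← sub_eq_add_neg]
  have hval : (∑' x, F x) = 2 * padicLog p (padicEval Sx w) - 2 * padicLog p (-w / Dv) := by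
    rw [htot, hlogSx, hloge]; ring
  rw [← hval]
  exact hrows

/-- **The norm identity in `tsum` form**: under the hypotheses of
`hasSum_coeff_padicLogSigmaSqShift_mul_powerSum`,
`2·log_p(−w/D) + Σ'_n [tⁿ]ℒ_p · t_n = 2·log_p 𝔖(w)`. [cite: MazurSteinTate2006, §2.8]
[cite: Silverman2005DivPoly, §5 Rem. 2] -/
theorem two_mul_padicLog_add_tsum_eq
    (hpair : ∃ Sq : ℚ_[p]⟦X⟧, ∃ c : ℚ_[p], W.IsMazurTateSigmaSqPair Sq c) {Sx : ℚ_[p]⟦X⟧}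
    (hinv : W.IsInvXExpansion W.padicSigmaSq Sx) {w : ℚ_[p]} (hw : ‖w‖ < 1) (hw0 : w ≠ 0)
    (t : ℕ → ℚ_[p]) (ht0 : t 0 = 2)
    (ht1 : t 1 = -(W.a₁ * w + W.a₃ * w ^ 2) / (1 + W.a₂ * w + W.a₄ * w ^ 2 + W.a₆ * w ^ 3))
    (ht : ∀ n, t (n + 2) =
      -(W.a₁ * w + W.a₃ * w ^ 2) / (1 + W.a₂ * w + W.a₄ * w ^ 2 + W.a₆ * w ^ 3) * t (n + 1) -
        -w / (1 + W.a₂ * w + W.a₄ * w ^ 2 + W.a₆ * w ^ 3) * t n) :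
    2 * padicLog p (-w / (1 + W.a₂ * w + W.a₄ * w ^ 2 + W.a₆ * w ^ 3)) +
        ∑' n : ℕ, coeff n W.padicLogSigmaSqShift * t n = 2 * padicLog p (padicEval Sx w) := by
  rw [(W.hasSum_coeff_padicLogSigmaSqShift_mul_powerSum hpair hinv hw hw0 t ht0 ht1 ht).tsum_eq]
  ring

end NormIdentity

end WeierstrassCurve

end
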